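import Summits.ResolutionOfSingularities.ResolutionOfSingularities.Theorems.EquisingularLiftEquisingularLiftNatSingularLocusFinite
import HarnessLib

/-!
# [OURS] THE POINT OVER A VECTOR AND THE JACOBIAN CRITERION AT IT: `F(v) = 0, ∇F(v) = 0, v ≠ 0 ⟹ V₊(F)` is NOT regular at `[v]` — the polynomial
# certificate for hypothesis #1 `¬ Scheme.IsRegular H` of the registered residual stubs
# (cruxes `Theses.EquisingularLift.EquisingularLiftNat` / `…NatThree`, stmt-ResolutionOfSingularities-20038 / -20148; every dimension, `K = K̄`)

[OURS · leafhand-res-equisingularlift-10 g1, 2026-08-31; cell `pub/decomp-res`] AI-produced, weaker than expert review; NOT a statement of any manuscript;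
nothing here proves resolution of singularities in positive characteristic.  DEF-FREE helper; no `sorry`; standard axioms; ZERO named hypotheses.

Third leaf of the closed-point Jacobian dictionary (✓ `…NatSingularVectors` p830488: regular OFF the singular vectors; ✓ `…NatSingularLocusFinite` p830641:
at most one point over a vector, finiteness).  Here the converse direction at a point:

* ★ `SingLocus.comap_chartPrime_eq_vanishingIdeal` / `linearForms_mem_of_comap_chartPrime_eq` — in the chart `x_c = 1` (`v_c ≠ 0`) a point lies over `v`
  iff its prime in `K[y]` is the maximal ideal of the affine trace `a = (v_j / v_c)_j`;
* ★★ `SingLocus.exists_point_of_eval_eq_zero` — **every vector `v` with `F(v) = 0` and `v_c ≠ 0` carries a point of `V₊(F)` over it** (the prime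
  `𝔪_a/(f)` of the chart ring);
* ★★★ `SingLocus.not_isRegularLocalRing_stalk_of_singularVector` — **if `F(v) = 0` and `∇F(v) = 0` then `V₊(F)` is not regular at any point over `v`**
  (`f = F(x_c:=1)` and its partials vanish at `a`, so `0 ≠ f ∈ 𝔪_a²` and `K[y]_{𝔪_a}/(f)` is not regular — tree
  ✓ `Resolution.not_isRegularLocalRing_localization_of_pderiv_eval_eq_zero`, Matsumura 14.2 — transported through the chart);
* ★★★ `SingLocus.not_isRegular_of_singularVector` — **a non-zero singular vector makes `V₊(F)` a non-regular scheme**: hypothesis #1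
  `¬ Scheme.IsRegular H` of both registered `n = 3` residual stubs, for `H = V₊(F)`, from one explicit vector.

With p830488/p830641 the dictionary is complete: for a prime form `F` over `K = K̄` the non-regular points of `V₊(F)` are exactly the (closed) points over
the non-zero singular vectors, one per line.  Honest label: closes no registered stub.

References: [Hartshorne1977, I Thm. 5.1, I Ex. 5.8, II Prop. 2.5]; [Matsumura1987, Thm. 14.2] — through the cited tree files.
-/

set_option linter.dupNamespace false -- mandated namespace `Summit.<Summit>.<Problem>` of this single-conjunct summit

noncomputable section

open CategoryTheory CategoryTheory.Limits AlgebraicGeometry TopologicalSpace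
open MvPolynomial HomogeneousLocalization
open Literature.AlgebraicGeometry.Resolution Literature.AlgebraicGeometry.Motives Literature.AlgebraicGeometry.GroupSchemes
open Literature.AlgebraicGeometry.Motives.SmoothHypersurface Literature.AlgebraicGeometry.Motives.ProjectiveSpace
open AlgebraicGeometry.Scheme.IdealSheafData
open Summit.ResolutionOfSingularities.ResolutionOfSingularities.Cruxes.EquisingularLift.StrataSplit

namespace Summit.ResolutionOfSingularities.ResolutionOfSingularities.Cruxes.EquisingularLiftNat.Sections

namespace SingLocus

variable (K : Type) [Field K] {m : ℕ} (F : MvPolynomial (Fin (m + 2 + 1)) K) {d : ℕ} (hF : F.IsHomogeneous d) (hd : 0 < d)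

/-- The cone vector over the affine trace of `v` is `v/v_c`. [folklore] -/
theorem insertNth_trace_eq (c : Fin (m + 2 + 1)) (v : Fin (m + 2 + 1) → K) (hvc : v c ≠ 0) :
    Fin.insertNth (α := fun _ => K) c (1 : K) (fun j => v (c.succAbove j) / v c) = fun i => (v c)⁻¹ * v i := by
  funext i
  rcases Fin.eq_self_or_eq_succAbove c i with rfl | ⟨j, rfl⟩
  · rw [Fin.insertNth_apply_same, inv_mul_cancel₀ hvc]
  · rw [Fin.insertNth_apply_succAbove, div_eq_inv_mul]

/-- **A form of degree `e` vanishing at `v` has its chart `G(x_c := 1)` vanishing at the affine trace of `v`** (`G(v/v_c) = v_c^{-e} G(v)`). [folklore] -/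
theorem eval_trace_dehomogenize_eq_zero (c : Fin (m + 2 + 1)) (v : Fin (m + 2 + 1) → K) (hvc : v c ≠ 0) {e : ℕ}
    {G : MvPolynomial (Fin (m + 2 + 1)) K} (hG : G.IsHomogeneous e) (hGv : eval v G = 0) :
    eval (fun j => v (c.succAbove j) / v c) (ProjectiveSpace.dehomogenize K c G) = 0 := by
  rw [← eval_insertNth_eq, insertNth_trace_eq K c v hvc]
  have h := ProjectiveSpace.isHomogeneous_aeval_const_mul hG (v c)⁻¹ v
  change eval (fun i => (v c)⁻¹ * v i) G = (v c)⁻¹ ^ e * eval v G at h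
  rw [h, hGv, mul_zero]

/-! ## The prime of a point over a vector -/

section Chart

variable (c : Fin (m + 2 + 1)) (v : Fin (m + 2 + 1) → K) (hvc : v c ≠ 0)

include hvc in
/-- ★ **The prime in `K[y]` of a chart point over `v` is `𝔪_{v/v_c}`**: it contains the `y_j − v_j/v_c` (dehomogenised linear forms through `v`,
✓ `HypersurfaceSpecimen.mem_asHomogeneousIdeal_chart_iff`), so its zero set is `⊆ {v/v_c}` and the Nullstellensatz makes it the maximal ideal.
[OURS] [cite: Hartshorne1977, II Prop. 2.5] -/
theorem comap_chartPrime_eq_vanishingIdeal [IsAlgClosed K] :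
    letI := MvPolynomial.gradedAlgebra (σ := Fin (m + 2 + 1)) (R := K)
    letI := ProjBaseChange.algebraBase (R := K) (homogeneousSubmodule (Fin (m + 2 + 1)) K) (Submonoid.powers (X c : MvPolynomial (Fin (m + 2 + 1)) K))
    ∀ (θ : ChartRing F c hF ≃+* (MvPolynomial (Fin (m + 2)) K ⧸ Ideal.span {ProjectiveSpace.dehomogenize K c F}))
      (_ : ∀ q, θ (toChartRing F c hF q) = Ideal.Quotient.mk _ (chartAlgEquiv K c q))
      (u : Spec (CommRingCat.of (ChartRing F c hF))),
      (∀ ℓ : MvPolynomial (Fin (m + 2 + 1)) K, ℓ.IsHomogeneous 1 → eval v ℓ = 0 →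
        ℓ ∈ ((hypersurfaceι F).left ((chart F c hF hd).left u)).asHomogeneousIdeal) →
      (u.asIdeal.comap θ.symm.toRingHom).comap (Ideal.Quotient.mk (Ideal.span {ProjectiveSpace.dehomogenize K c F})) =
        MvPolynomial.vanishingIdeal K ({fun j => v (c.succAbove j) / v c} : Set (Fin (m + 2) → K)) := by
  letI := MvPolynomial.gradedAlgebra (σ := Fin (m + 2 + 1)) (R := K)
  letI := ProjBaseChange.algebraBase (R := K) (homogeneousSubmodule (Fin (m + 2 + 1)) K)
    (Submonoid.powers (X c : MvPolynomial (Fin (m + 2 + 1)) K))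
  set f := ProjectiveSpace.dehomogenize K c F with hfdef
  intro θ hθ u hu
  classical
  set a : Fin (m + 2) → K := fun j => v (c.succAbove j) / v c with hadef
  set P := (u.asIdeal.comap θ.symm.toRingHom).comap (Ideal.Quotient.mk (Ideal.span {f})) with hPdef
  haveI : (u.asIdeal.comap θ.symm.toRingHom).IsPrime := Ideal.comap_isPrime _ _
  haveI hPprime : P.IsPrime := Ideal.comap_isPrime _ _
  have hdict : ∀ {G : MvPolynomial (Fin (m + 2 + 1)) K}, G.IsHomogeneous 1 →
      (G ∈ ((hypersurfaceι F).left ((chart F c hF hd).left u)).asHomogeneousIdeal ↔ ProjectiveSpace.dehomogenize K c G ∈ P) := by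
    intro G hG
    have hG' : G ∈ homogeneousSubmodule (Fin (m + 2 + 1)) K 1 := (mem_homogeneousSubmodule 1 G).mpr hG
    rw [HypersurfaceSpecimen.mem_asHomogeneousIdeal_chart_iff K F hF hd c one_pos hG' u, hPdef, Ideal.mem_comap, Ideal.mem_comap,
      ← HypersurfaceSpecimen.chartAlgEquiv_isLocalizationElem K c hG', ← hθ]
    change _ ↔ θ.symm (θ _) ∈ u.asIdeal
    rw [RingEquiv.symm_apply_apply]
  have hlin : ∀ j : Fin (m + 2), (X j - C (a j) : MvPolynomial (Fin (m + 2)) K) ∈ P := by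
    intro j
    have hℓ : (X (c.succAbove j) - C (a j) * X c : MvPolynomial (Fin (m + 2 + 1)) K).IsHomogeneous 1 := by
      have h2 := (isHomogeneous_C (Fin (m + 2 + 1)) (a j)).mul (isHomogeneous_X K c)
      rw [zero_add] at h2
      exact (isHomogeneous_X K (c.succAbove j)).sub h2
    have hℓv : eval v (X (c.succAbove j) - C (a j) * X c : MvPolynomial (Fin (m + 2 + 1)) K) = 0 := by
      simp only [map_sub, map_mul, eval_C, eval_X, hadef]
      rw [div_mul_cancel₀ _ hvc, sub_self]
    have h := (hdict hℓ).mp (hu _ hℓ hℓv)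
    rwa [map_sub, map_mul, ProjectiveSpace.dehomogenize_X_succAbove, ProjectiveSpace.dehomogenize_X_self, mul_one,
      MvPolynomial.algHom_C] at h
  have hZ : MvPolynomial.zeroLocus K P ⊆ ({a} : Set (Fin (m + 2) → K)) := by
    intro b hb
    rw [MvPolynomial.mem_zeroLocus_iff] at hb
    refine Set.mem_singleton_iff.mpr (funext fun j => ?_)
    have h := hb _ (hlin j)
    change eval b (X j - C (a j)) = 0 at h
    rwa [map_sub, eval_X, eval_C, sub_eq_zero] at h
  have hle : MvPolynomial.vanishingIdeal K ({a} : Set (Fin (m + 2) → K)) ≤ P := by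
    rw [← MvPolynomial.IsPrime.vanishingIdeal_zeroLocus (K := K) P]
    exact MvPolynomial.vanishingIdeal_anti_mono hZ
  have hmax : (MvPolynomial.vanishingIdeal K ({a} : Set (Fin (m + 2) → K)) : Ideal (MvPolynomial (Fin (m + 2)) K)).IsMaximal :=
    inferInstance
  exact (hmax.eq_of_le hPprime.ne_top hle).symm

include hvc in
/-- ★ **Conversely, a chart point whose prime in `K[y]` is `𝔪_{v/v_c}` lies over `v`**: a linear form through `v` dehomogenises to a polynomial
vanishing at `v/v_c` (`ℓ(v/v_c) = ℓ(v)/v_c = 0`). [OURS] [cite: Hartshorne1977, II Prop. 2.5] -/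
theorem linearForms_mem_of_comap_chartPrime_eq :
    letI := MvPolynomial.gradedAlgebra (σ := Fin (m + 2 + 1)) (R := K)
    letI := ProjBaseChange.algebraBase (R := K) (homogeneousSubmodule (Fin (m + 2 + 1)) K) (Submonoid.powers (X c : MvPolynomial (Fin (m + 2 + 1)) K))
    ∀ (θ : ChartRing F c hF ≃+* (MvPolynomial (Fin (m + 2)) K ⧸ Ideal.span {ProjectiveSpace.dehomogenize K c F}))
      (_ : ∀ q, θ (toChartRing F c hF q) = Ideal.Quotient.mk _ (chartAlgEquiv K c q))
      (u : Spec (CommRingCat.of (ChartRing F c hF))),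
      (u.asIdeal.comap θ.symm.toRingHom).comap (Ideal.Quotient.mk (Ideal.span {ProjectiveSpace.dehomogenize K c F})) =
        MvPolynomial.vanishingIdeal K ({fun j => v (c.succAbove j) / v c} : Set (Fin (m + 2) → K)) →
      ∀ ℓ : MvPolynomial (Fin (m + 2 + 1)) K, ℓ.IsHomogeneous 1 → eval v ℓ = 0 →
        ℓ ∈ ((hypersurfaceι F).left ((chart F c hF hd).left u)).asHomogeneousIdeal := by
  letI := MvPolynomial.gradedAlgebra (σ := Fin (m + 2 + 1)) (R := K)
  letI := ProjBaseChange.algebraBase (R := K) (homogeneousSubmodule (Fin (m + 2 + 1)) K)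
    (Submonoid.powers (X c : MvPolynomial (Fin (m + 2 + 1)) K))
  intro θ hθ u hP ℓ hℓ hℓv
  have hℓ' : ℓ ∈ homogeneousSubmodule (Fin (m + 2 + 1)) K 1 := (mem_homogeneousSubmodule 1 ℓ).mpr hℓ
  rw [HypersurfaceSpecimen.mem_asHomogeneousIdeal_chart_iff K F hF hd c one_pos hℓ' u]
  have hmem : ProjectiveSpace.dehomogenize K c ℓ ∈
      (u.asIdeal.comap θ.symm.toRingHom).comap (Ideal.Quotient.mk (Ideal.span {ProjectiveSpace.dehomogenize K c F})) := by
    rw [hP, MvPolynomial.mem_vanishingIdeal_singleton_iff]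
    exact eval_trace_dehomogenize_eq_zero K c v hvc hℓ hℓv
  rw [Ideal.mem_comap, Ideal.mem_comap, ← HypersurfaceSpecimen.chartAlgEquiv_isLocalizationElem K c hℓ', ← hθ] at hmem
  change θ.symm (θ _) ∈ u.asIdeal at hmem
  rwa [RingEquiv.symm_apply_apply] at hmem

end Chart

/-! ## The point over a vector of `V(F)` and the Jacobian criterion at it -/

include hF in
/-- ★★ **Every vector `v` with `F(v) = 0` and `v_c ≠ 0` carries a point of `V₊(F)` over it** (`F` a prime form over `K = K̄`): the prime `𝔪_{v/v_c}/(f)` of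
the chart ring `ChartRing F c ≅ K[y]/(f)`, `f = F(x_c := 1)` (`f ∈ 𝔪_{v/v_c}` because `f(v/v_c) = v_c^{-d} F(v) = 0`). [OURS] [cite: Hartshorne1977, II Prop. 2.5] -/
theorem exists_point_of_eval_eq_zero [IsAlgClosed K] (hFp : Prime F) (c : Fin (m + 2 + 1)) (v : Fin (m + 2 + 1) → K) (hvc : v c ≠ 0)
    (hFv : eval v F = 0) :
    letI := MvPolynomial.gradedAlgebra (σ := Fin (m + 2 + 1)) (R := K)
    ∃ x : ↥(hypersurface F).left,
      ∀ ℓ : MvPolynomial (Fin (m + 2 + 1)) K, ℓ.IsHomogeneous 1 → eval v ℓ = 0 → ℓ ∈ ((hypersurfaceι F).left x).asHomogeneousIdeal := by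
  letI := MvPolynomial.gradedAlgebra (σ := Fin (m + 2 + 1)) (R := K)
  letI := ProjBaseChange.algebraBase (R := K) (homogeneousSubmodule (Fin (m + 2 + 1)) K)
    (Submonoid.powers (X c : MvPolynomial (Fin (m + 2 + 1)) K))
  classical
  have hd : 0 < d := ConeN.pos_of_prime_of_isHomogeneous K F hF hFp
  set f := ProjectiveSpace.dehomogenize K c F with hfdef
  set a : Fin (m + 2) → K := fun j => v (c.succAbove j) / v c with hadef
  have hrad : (Ideal.span {f}).radical = Ideal.span {f} := by
    rcases ProjectiveSpace.irreducible_or_isUnit_dehomogenize (i := c) hF hFp.irreducible with hirr | hu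
    · exact ((Ideal.span_singleton_prime hirr.ne_zero).mpr (UniqueFactorizationMonoid.irreducible_iff_prime.mp hirr)).radical
    · rw [Ideal.span_singleton_eq_top.mpr hu, Ideal.radical_top]
  obtain ⟨θ, hθ⟩ := HypersurfaceSpecimen.exists_chartQuotEquiv_apply K F hF c f rfl hrad
  -- the maximal ideal `𝔪_a ∋ f` and its image in `K[y]/(f)`
  set 𝔪 : Ideal (MvPolynomial (Fin (m + 2)) K) := MvPolynomial.vanishingIdeal K ({a} : Set (Fin (m + 2) → K)) with h𝔪def
  haveI h𝔪max : 𝔪.IsMaximal := inferInstance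
  have hf𝔪 : f ∈ 𝔪 := by
    rw [h𝔪def, MvPolynomial.mem_vanishingIdeal_singleton_iff]
    exact eval_trace_dehomogenize_eq_zero K c v hvc hF hFv
  have hker : RingHom.ker (Ideal.Quotient.mk (Ideal.span {f})) ≤ 𝔪 := by
    rw [Ideal.mk_ker]
    exact (Ideal.span_singleton_le_iff_mem _).mpr hf𝔪
  set 𝔮' : Ideal (MvPolynomial (Fin (m + 2)) K ⧸ Ideal.span {f}) := 𝔪.map (Ideal.Quotient.mk (Ideal.span {f})) with h𝔮'def
  haveI : 𝔮'.IsPrime := Ideal.map_isPrime_of_surjective Ideal.Quotient.mk_surjective hker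
  have h𝔮'comap : 𝔮'.comap (Ideal.Quotient.mk (Ideal.span {f})) = 𝔪 := by
    rw [h𝔮'def, Ideal.comap_map_of_surjective _ Ideal.Quotient.mk_surjective, sup_eq_left]
    rw [← RingHom.ker_eq_comap_bot]
    exact hker
  -- the point of the chart ring
  let u : Spec (CommRingCat.of (ChartRing F c hF)) := ⟨𝔮'.comap θ.toRingHom, Ideal.comap_isPrime _ _⟩
  have hu : u.asIdeal.comap θ.symm.toRingHom = 𝔮' := by
    ext q
    rw [Ideal.mem_comap]
    change θ (θ.symm q) ∈ 𝔮' ↔ _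
    rw [RingEquiv.apply_symm_apply]
  refine ⟨(chart F c hF hd).left u, linearForms_mem_of_comap_chartPrime_eq K F hF hd c v hvc θ hθ u ?_⟩
  rw [hu, h𝔮'comap]

include hF in
/-- ★★★ **THE JACOBIAN CRITERION AT A POINT, FROM THE VECTOR**: if `F(v) = 0` and `∂ᵢF(v) = 0` for all `i` (`F` a prime form over `K = K̄`), then `V₊(F)` is
NOT regular at any point lying over `v`.  Chart `x_c = 1` with `v_c ≠ 0`: the point's prime in `K[y]` is `𝔪_{v/v_c}` (`comap_chartPrime_eq_vanishingIdeal`),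
`f = F(x_c:=1) ≠ 0` and all `∂ⱼf = (∂_{c⁺j}F)(x_c:=1)` vanish at `v/v_c` (homogeneity), so `K[y]_{𝔪}/(f)` is not regular (tree
✓ `not_isRegularLocalRing_localization_of_pderiv_eval_eq_zero`), and `𝒪_{V₊(F),x} ≅ (ChartRing F c)_𝔭 ≅ (K[y]/(f))_{𝔪}`.
[OURS] [cite: Hartshorne1977, I Thm. 5.1, I Ex. 5.8] [cite: Matsumura1987, Thm. 14.2] -/
theorem not_isRegularLocalRing_stalk_of_singularVector [IsAlgClosed K] (hFp : Prime F) (v : Fin (m + 2 + 1) → K)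
    (hFv : eval v F = 0) (hdFv : ∀ i, eval v (pderiv i F) = 0) :
    letI := MvPolynomial.gradedAlgebra (σ := Fin (m + 2 + 1)) (R := K)
    ∀ x : ↥(hypersurface F).left,
      (∀ ℓ : MvPolynomial (Fin (m + 2 + 1)) K, ℓ.IsHomogeneous 1 → eval v ℓ = 0 → ℓ ∈ ((hypersurfaceι F).left x).asHomogeneousIdeal) →
      ¬ IsRegularLocalRing ((hypersurface F).left.presheaf.stalk x) := by
  letI := MvPolynomial.gradedAlgebra (σ := Fin (m + 2 + 1)) (R := K)
  intro x hx hreg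
  classical
  have hd : 0 < d := ConeN.pos_of_prime_of_isHomogeneous K F hF hFp
  obtain ⟨⟨c, hvc⟩, hxc⟩ := mem_basicOpen_of_linearForms_mem K F v x hx
  letI := ProjBaseChange.algebraBase (R := K) (homogeneousSubmodule (Fin (m + 2 + 1)) K)
    (Submonoid.powers (X c : MvPolynomial (Fin (m + 2 + 1)) K))
  have hxr : x ∈ Set.range (chart F c hF hd).left := by rw [range_chart_left]; exact hxc c hvc
  obtain ⟨u, rfl⟩ := hxr
  set f := ProjectiveSpace.dehomogenize K c F with hfdef
  set a : Fin (m + 2) → K := fun j => v (c.succAbove j) / v c with hadef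
  have hrad : (Ideal.span {f}).radical = Ideal.span {f} := by
    rcases ProjectiveSpace.irreducible_or_isUnit_dehomogenize (i := c) hF hFp.irreducible with hirr | hu
    · exact ((Ideal.span_singleton_prime hirr.ne_zero).mpr (UniqueFactorizationMonoid.irreducible_iff_prime.mp hirr)).radical
    · rw [Ideal.span_singleton_eq_top.mpr hu, Ideal.radical_top]
  have hf0 : f ≠ 0 := by
    rcases ProjectiveSpace.irreducible_or_isUnit_dehomogenize (i := c) hF hFp.irreducible with hirr | hu
    · exact hirr.ne_zero
    · exact hu.ne_zero
  obtain ⟨θ, hθ⟩ := HypersurfaceSpecimen.exists_chartQuotEquiv_apply K F hF c f rfl hrad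
  -- the prime `𝔮'` of `K[y]/(f)` and its contraction `𝔪_a`
  set 𝔮' : Ideal (MvPolynomial (Fin (m + 2)) K ⧸ Ideal.span {f}) := u.asIdeal.comap θ.symm.toRingHom with h𝔮'def
  haveI : 𝔮'.IsPrime := Ideal.comap_isPrime _ _
  have hP : 𝔮'.comap (Ideal.Quotient.mk (Ideal.span {f})) = RingHom.ker (eval a) := by
    rw [h𝔮'def, comap_chartPrime_eq_vanishingIdeal K F hF hd c v hvc θ hθ u hx]
    ext q
    rw [MvPolynomial.mem_vanishingIdeal_singleton_iff, RingHom.mem_ker]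
    rfl
  -- `f` and its partials vanish at `a`
  have hfa : eval a f = 0 := eval_trace_dehomogenize_eq_zero K c v hvc hF hFv
  have hdfa : ∀ j, eval a (pderiv j f) = 0 := fun j => by
    rw [hfdef, ProjectiveSpace.pderiv_dehomogenize]
    exact eval_trace_dehomogenize_eq_zero K c v hvc hF.pderiv (hdFv _)
  have hnot : ¬ IsRegularLocalRing (Localization.AtPrime 𝔮') :=
    not_isRegularLocalRing_localization_of_pderiv_eval_eq_zero a hf0 hfa hdfa 𝔮' hP
  -- the stalk is that localisation
  have hmem : ∀ q, q ∈ 𝔮' ↔ θ.symm q ∈ u.asIdeal := fun q => by rw [h𝔮'def, Ideal.mem_comap]; rfl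
  exact hnot (OrdPoint.isRegularLocalRing_localization_of_ringEquiv θ u.asIdeal 𝔮'
    (fun y => by rw [hmem, RingEquiv.symm_apply_apply]) (isRegularLocalRing_localization_of_stalk_chart K F hF hd c u hreg))

include hF in
/-- ★★★ **A NON-ZERO SINGULAR VECTOR MAKES `V₊(F)` A NON-REGULAR SCHEME** (`F` a prime form over `K = K̄`; `v ≠ 0`, `F(v) = 0`, `∇F(v) = 0`): hypothesis #1
`¬ Scheme.IsRegular H` of both registered `n = 3` residual stubs, for `H = V₊(F)`, from one explicit vector (`exists_point_of_eval_eq_zero` +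
`not_isRegularLocalRing_stalk_of_singularVector`). [OURS] [cite: Hartshorne1977, I Thm. 5.1, I Ex. 5.8] -/
theorem not_isRegular_of_singularVector [IsAlgClosed K] (hFp : Prime F) (v : Fin (m + 2 + 1) → K) (hv : v ≠ 0)
    (hFv : eval v F = 0) (hdFv : ∀ i, eval v (pderiv i F) = 0) :
    letI := MvPolynomial.gradedAlgebra (σ := Fin (m + 2 + 1)) (R := K)
    ¬ Scheme.IsRegular (hypersurface F).left := by
  letI := MvPolynomial.gradedAlgebra (σ := Fin (m + 2 + 1)) (R := K)
  intro hreg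
  obtain ⟨c, hvc⟩ := Function.ne_iff.mp hv
  obtain ⟨x, hx⟩ := exists_point_of_eval_eq_zero K F hF hFp c v hvc hFv
  exact not_isRegularLocalRing_stalk_of_singularVector K F hF hFp v hFv hdFv x hx (hreg x)

end SingLocus

end Summit.ResolutionOfSingularities.ResolutionOfSingularities.Cruxes.EquisingularLiftNat.Sections

end
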